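import Summits.HodgeConjecture.HodgeConjecture.Theorems.F0LD1ThetaSliceOfBricks
import Summits.HodgeConjecture.HodgeConjecture.Theorems.F0LD1ThetaSliceHermiteSum
import Summits.HodgeConjecture.HodgeConjecture.Theorems.F0LD1ThetaSliceTorusProjectorOrgan
import Summits.HodgeConjecture.HodgeConjecture.Theorems.F0LD1ThetaSliceFiniteLevel
import Summits.HodgeConjecture.HodgeConjecture.Theorems.F0LD1ThetaSliceMeasureScaling
import HarnessLib

-- the organ statement elaborates to a very large type; elaborate sequentially (as in the ★ kit lineage)
set_option Elab.async false

/-!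
# Crux `HLiu418`, line LD1 — ORGAN (Gβ) `F0LD1ThetaGermDefs.ThetaSlice₂` HOLDS (sorry-free, by name)

Cell hodgecm-mathlib, floor 0; seat LD1-p01 (g3); `--supports stmt-HodgeConjecture-24832 --as helper`.  THEOREMS ONLY.
The (Gβ) organ of LD1-plan (g2)'s (I′) germ road — «an admissible non-zero finite-rank equivariant slice of the line theta span» — is the
junction ★ `F0LD1ThetaSliceOfBricks.thetaSlice₂_of_bricks` (p850950) applied to its four ★ bricks:
(Gβ-Σ) ★ `F0LD1ThetaSliceHermiteSum.hermiteSum_holds` (p850959), (Gβ-P) ★ `F0LD1ThetaSliceTorusProjector.torusProjector_holds` (LD1-p02),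
(Gβ-L) ★ `F0LD1ThetaSliceFiniteLevel.finiteLevel_holds` (p850996), (Gβ-M) ★ `F0LD1ThetaSliceMeasureScaling.measureScaling_holds` (A-p12).
One ★ name for the closed organ, so the leaf's `stub_organ_thetaSlice` and LD2's twin socket dock by `:= F0LD1ThetaSlice.thetaSlice₂_holds`.

HONEST LABEL.  Nothing printed is discharged; HC_CM is proved only modulo the 7 printed citations (2 remaining: hLiu418 = stmt-HodgeConjecture-24832,
h413 = stmt-HodgeConjecture-24833) until rung 0 closes; count-neutral.
References (prose locators): Borel–Jacquet 1979 §4.6; Mœglin–Vignéras–Waldspurger 1987 Chap. 3 IV.4; Rallis 1984 §1.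
-/

set_option autoImplicit false
set_option linter.dupNamespace false

namespace Summit.HodgeConjecture.HodgeConjecture.Cruxes.HLiu418.F0LD1ThetaSlice

/-- **ORGAN (Gβ) `ThetaSlice₂` HOLDS**: the line theta span in `L²([U(H)], μ)` is `0` or carries bounded operators `A`, `P` preserving closed
invariant subspaces with a non-zero finite-dimensional Hermite slice receiving `P (A c)` for every generator `c` (★ `thetaSlice₂_of_bricks` at the four
★ bricks). [cite: BorelJacquet1979, §4.6] [cite: MoeglinVignerasWaldspurger1987, Chap. 3 IV.4] -/
theorem thetaSlice₂_holds : F0LD1ThetaGermDefs.ThetaSlice₂ :=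
  F0LD1ThetaSliceOfBricks.thetaSlice₂_of_bricks F0LD1ThetaSliceHermiteSum.hermiteSum_holds
    F0LD1ThetaSliceTorusProjector.torusProjector_holds F0LD1ThetaSliceFiniteLevel.finiteLevel_holds
    F0LD1ThetaSliceMeasureScaling.measureScaling_holds

end Summit.HodgeConjecture.HodgeConjecture.Cruxes.HLiu418.F0LD1ThetaSlice
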